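import Summits.CriticalPhenomena.PercolationContinuityZ3.Theorems.PercNearOneGluingNoHeavyQuantLawDecFlows
import HarnessLib

/-!
# QUANT lane R8, FULL-SGC line: the pair mean of a product mid arc at its minimal gate never exceeds the target
# (the 'pair mean ≤ τ' side condition of the remainder dichotomy is automatic under top-affordability)

builds on p205010 (kernel theorem, internal audit signed; external expert review pending)

Support file (`--supports stmt-CriticalPhenomena-4575`), QUANT lane seat prim-quant-census-2 (gen 63), rung R8 of
`run/shared/lean/prim/quant/LADDER.md`.  Theorems only, standard axioms, no sorries.  Census memo: `run/shared/lean/prim/quant/prim-quant-census-2-g63/NP-STEP-G63.md` §1.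

WHAT.  In the FULL-SGC construction (arm-2 g37 L2-TRANSPORT §8, census-2 g62 SGC-GENERAL §13) the remainder after all mid placements is closed EITHER by the
giants OR — when every nonzero low is placed — by the merged first-moment criterion (`flowAtT_of_moment`-type).  The moment branch needs every placed
two-point component `{t, k; γ}` (low `t`, mid `k`, `γ = pairGate y τ t k` its minimal gate) to have mean `t + (k − t)·γ ≤ τ`, so that removing it keeps
the remainder's mean `≥ τ`.  census-2 g62 guarded this with an arc filter ('GREEDYH') and recorded 'exceptions'.  THIS FILE: the condition is AUTOMATIC —
for `0 ≤ y`, `t < k` and `y·k ≤ τ` (every absorber `k ≤ M` of a top-affordable law, `y·M ≤ τ`): `t + (k − t)·pairGate y τ t k ≤ τ`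
(heavy: `= τ − t`; light: `≤ τ − t(1−y)²`).  Exact check of the engine: 228 252 valid pairs, max(mean − τ) = 0; the recorded 'exceptions' were 10⁻¹²-tolerance
artefacts (memo §1).  Consequence for the Lean assembly: the AP branch of the remainder lemma is an identity-level consequence of TA (`pairMoment_le`).

* `LawDec.pairMean_le_target` — `t + (k − t)·pairGate y τ t k ≤ τ` under `0 ≤ y`, `t < k`, `y·k ≤ τ` (nothing else is needed).
* `LawDec.pairMoment_le` — moment form consumed by the merged-moment remainder: for a mid `k ≤ j′` compatible with `t` and an amount `x ≥ 0` shipped at the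
  product rate, `t·x + k·(usage·x) ≤ τ·(x + usage·x)`.

[this work]; rates / flow normal form: this lane (typer g22/g25, lead g21).  Nothing here is cited as a published result.  The gluing rows served
[cite: KozmaNitzan2024, Conjecture 3 (p. 15)]; product measure [cite: Grimmett1999, §1.3 p. 10].
-/

noncomputable section

namespace Summit.CriticalPhenomena.PercolationContinuityZ3.Theorems

namespace Quant

namespace LawDec

/-- **The pair mean at the minimal gate never exceeds the target.**  For a floor `0 < y < 1`, a low `t` (`2t < τ`) and an absorber `k > t` that is
affordable at `y` (`y·k ≤ τ`, e.g. any `k ≤ M` of a top-affordable law), `0 ≤ y`, the two-point law `{t, k; pairGate y τ t k}` has mean `≤ τ`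
(the low condition `2t < τ` and `y < 1` are not even needed):
heavy gate `ρ = (τ−2t)/(k−t)` gives mean `τ − t`; light gate `y² + (1−y)ρ` gives `t + (k−t)y² + (1−y)(τ−2t) ≤ τ − t(1−y)²`
because `(k−t)y² ≤ y·(y k) − y²t ≤ yτ − y²t`. [this work] -/
theorem pairMean_le_target (y τ : ℝ) (t k : ℕ) (hy0 : 0 ≤ y) (htk : t < k)
    (hta : y * (k : ℝ) ≤ τ) : (t : ℝ) + ((k : ℝ) - t) * pairGate y τ t k ≤ τ := by
  have hd : (0 : ℝ) < (k : ℝ) - t := by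
    have : (t : ℝ) < k := by exact_mod_cast htk
    linarith
  have ht0 : (0 : ℝ) ≤ t := Nat.cast_nonneg t
  have hρ : ((k : ℝ) - t) * ((τ - 2 * (t : ℝ)) / ((k : ℝ) - t)) = τ - 2 * (t : ℝ) := by
    field_simp
  unfold pairGate
  rcases le_total (y ^ 2 + (1 - y) * ((τ - 2 * (t : ℝ)) / ((k : ℝ) - t))) ((τ - 2 * (t : ℝ)) / ((k : ℝ) - t)) with h | h
  · rw [max_eq_left h, hρ]; linarith
  · rw [max_eq_right h, mul_add, ← mul_assoc, mul_comm ((k : ℝ) - t) (1 - y), mul_assoc, hρ]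
    nlinarith [mul_nonneg ht0 (sq_nonneg (1 - y)), mul_le_mul_of_nonneg_left hta hy0]

/-- **Moment form.**  For a low `t` (`2t < τ`), a mid `k ≤ j′` with `t < k`, `τ < t + k` (compatible) and `y·k ≤ τ`, `0 < y < 1`, and an amount `x ≥ 0`
of low mass shipped to `k` at the rate `usage y τ j′ t k` (`= γ/(1−γ)`, `γ = pairGate y τ t k < 1`), the removed two-point component has first moment at
most `τ` times its mass: `t·x + k·(usage·x) ≤ τ·(x + usage·x)`.  This keeps the remainder's mean `≥ τ` in the all-placed branch. [this work] -/
theorem pairMoment_le (y τ x : ℝ) (j' t k : ℕ) (hy0 : 0 < y) (hy1 : y < 1) (htk : t < k) (hkj : k ≤ j') (hlow : 2 * (t : ℝ) < τ)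
    (hcomp : τ < (t : ℝ) + k) (hta : y * (k : ℝ) ≤ τ) (hx : 0 ≤ x) :
    (t : ℝ) * x + (k : ℝ) * (usage y τ j' t k * x) ≤ τ * (x + usage y τ j' t k * x) := by
  have hmid : ¬ (j' + 1 ≤ k) := by omega
  have hgate : gateOf y τ j' t k = pairGate y τ t k := by
    unfold gateOf; rw [if_neg hmid]
  have hγ1 : pairGate y τ t k < 1 := pairGate_lt_one y τ t k hy0 hy1 hlow hcomp
  have hmean := pairMean_le_target y τ t k hy0.le htk hta
  set γ := pairGate y τ t k with hγ
  have hus : usage y τ j' t k = γ / (1 - γ) := by unfold usage; rw [hgate]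
  have h1γ : (1 : ℝ) - γ ≠ 0 := by linarith
  have h1γ' : (0 : ℝ) ≤ 1 - γ := by linarith
  rw [hus]
  have eL : (t : ℝ) * x + (k : ℝ) * (γ / (1 - γ) * x) = x * ((t : ℝ) + ((k : ℝ) - t) * γ) / (1 - γ) := by
    field_simp; ring
  have eR : τ * (x + γ / (1 - γ) * x) = x * τ / (1 - γ) := by
    field_simp; ring
  rw [eL, eR]
  exact div_le_div_of_nonneg_right (mul_le_mul_of_nonneg_left hmean hx) h1γ'

end LawDec

end Quant

end Summit.CriticalPhenomena.PercolationContinuityZ3.Theorems
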